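import Literature.NumberTheory.DiophantineGeometry.FunctionFieldConstantExtensionRationalPlaces
import Literature.NumberTheory.DiophantineGeometry.FunctionFieldSchmidtDegreeOneExtensionProofs
import Literature.NumberTheory.DiophantineGeometry.FunctionFieldGenusRiemannRochProofs
import Literature.NumberTheory.DiophantineGeometry.FunctionFieldGenusApproximationProofs
import HarnessLib

/-!
# Function fields of one variable: an element divisible modulo constant field extensions is constant

Support file for the slimness of `Δ_{η_X}` in [AbsTopIII] Theorem 1.11
(`FunctionFieldGeometricSlimProofs`).  Let `F/k` be an algebraic function field of one variable,
`char k = 0`, and `Ω ⊇ F` any field.  The main result `isAlgebraic_of_forall_exists_pow_eq`: if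
`c ∈ F^×` is, for every `n ≥ 1`, an `n`-th power in a compositum `F·N ⊆ Ω` with `N/k` finite, then
`c` is algebraic over `k`.  Proof (H. Stichtenoth, *Algebraic Function Fields and Codes*, GTM 254):
over the exact constant field `k̃` of `F` (§1.1; `isAlgFunctionField_algebraicClosure_of_field`,
`isIntegrallyClosedIn_algebraicClosure_of_field`) a non-constant `c` has a pole `P` (Cor. 1.1.20,
tree `exists_placeOver_not_mem`); `F·N = F(t) ≅ F[X]/(φ)` with `φ` the minimal polynomial over
`k̃` of a primitive element `t`, a constant field extension, which is UNRAMIFIED (Thm. 3.6.3 (a),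
tree `ord_algebraMap_eq_ord_restrict`); at a place `Q` above `P`
(`exists_placeOver_adjoinRoot_restrict_eq`, Prop. 3.1.7 (b) via Chevalley, here for an arbitrary —
not necessarily finite — constant field) one gets `ord_P(c) = n · ord_Q(β)`, absurd for
`n > |ord_P(c)|`.

HONEST FRAMING: classical function field arithmetic; nothing here bears on [IUTchIII] Cor. 3.12.
[cite: Stichtenoth2009, Thm. 3.6.3(a), Cor. 1.1.20, Prop. 3.1.7(b)]
-/

noncomputable section

open scoped Classical Polynomial IntermediateField

namespace Literature.AnabelianGeometry.AbsoluteAnabelian.AbsTopIII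

open Polynomial
open Literature.NumberTheory.DiophantineGeometry
open Literature.NumberTheory.DiophantineGeometry.AlgFunctionField

universe u v w

/-! ### The exact constant field of a function field (Stichtenoth §1.1, `K̃`) -/

section ConstantField

variable {k : Type u} {F : Type v} [Field k] [Field F] [Algebra k F]

/-- The field `k̃ ⊆ F` of elements algebraic over `k` is integrally (= algebraically) closed in `F`
(Stichtenoth §1.1: `K̃` is the full constant field). [cite: Stichtenoth2009, §1.1] -/
theorem isIntegrallyClosedIn_algebraicClosure_of_field :
    IsIntegrallyClosedIn (algebraicClosure k F) F := by
  rw [isIntegrallyClosedIn_iff]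
  refine ⟨(algebraMap (algebraicClosure k F) F).injective, fun {x} hx => ?_⟩
  have hx' : IsIntegral k x := isIntegral_trans x hx
  exact ⟨⟨x, mem_algebraicClosure_iff'.2 hx'⟩, rfl⟩

/-- `F/k̃` is again an algebraic function field of one variable (`trdeg` is unchanged over an
algebraic extension of the constants, finite generation is inherited; Stichtenoth §1.1).
[cite: Stichtenoth2009, §1.1] -/
theorem isAlgFunctionField_algebraicClosure_of_field [IsAlgFunctionField k F] :
    IsAlgFunctionField (algebraicClosure k F) F where
  trdeg_eq_one := by
    have h := lift_trdeg_add_eq k (algebraicClosure k F) F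
    rw [trdeg_eq_zero (R := k) (A := algebraicClosure k F),
      IsAlgFunctionField.trdeg_eq_one (K := k) (F := F),
      Cardinal.lift_zero, zero_add, Cardinal.lift_one] at h
    exact Cardinal.lift_eq_one.1 h
  fg_top := by
    haveI : Algebra.EssFiniteType k F := IntermediateField.fg_top_iff.1 IsAlgFunctionField.fg_top
    exact IntermediateField.fg_top_iff.2 (Algebra.EssFiniteType.of_comp k (algebraicClosure k F) F)

end ConstantField

/-! ### A place of the constant field extension `F[X]/(φ)` above a given place (Chevalley) -/

section PlaceAbove

variable {K : Type u} {F : Type v} [Field K] [Field F] [Algebra K F] [IsAlgFunctionField K F]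
  [IsIntegrallyClosedIn K F] (φ : K[X]) [Fact (Irreducible φ)]

/-- **A place of `F' = F[X]/(φ)` over `K' = K[X]/(φ)` above a place `P` of `F/K`** (Stichtenoth
Prop. 3.1.7 (b)), for an ARBITRARY constant field `K` (the tree's `PlaceOver.exists_restrict_eq`
assumes `K'` finite): Chevalley's extension theorem (`IsLocalRing.exists_factor_valuationRing`)
gives a valuation ring `O'` of `F'` dominating `O_P`, whence `O' ∩ F = O_P` and `O' ≠ F'`; and
`K' ⊆ O'` because `K'` is algebraic over `K ⊆ O'` (`mem_valuationSubring_of_isAlgebraic`).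
[cite: Stichtenoth2009, Prop. 3.1.7(b)] -/
theorem exists_placeOver_adjoinRoot_restrict_eq (P : PlaceOver K F) :
    ∃ Q : PlaceOver (AdjoinRoot φ) (AdjoinRoot (φ.map (algebraMap K F))),
      Q.restrict (K := K) (F := F) = P := by
  set f : P.toValuationSubring →+* AdjoinRoot (φ.map (algebraMap K F)) :=
    (algebraMap F (AdjoinRoot (φ.map (algebraMap K F)))).comp P.toValuationSubring.subtype with hf
  obtain ⟨A, hA, hloc⟩ := IsLocalRing.exists_factor_valuationRing f
  -- `A ∩ F ⊆ O_P` (domination)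
  have key : ∀ x : F, algebraMap F (AdjoinRoot (φ.map (algebraMap K F))) x ∈ A →
      x ∈ P.toValuationSubring := by
    intro x hx
    by_contra hxP
    have hx0 : x ≠ 0 := by
      rintro rfl
      exact hxP (zero_mem _)
    have hxinv : x⁻¹ ∈ P.toValuationSubring :=
      (P.toValuationSubring.mem_or_inv_mem x).resolve_left hxP
    have hu : IsUnit (f.codRestrict A.toSubring hA ⟨x⁻¹, hxinv⟩) := by
      refine IsUnit.of_mul_eq_one ⟨algebraMap F _ x, hx⟩ ?_
      apply Subtype.ext
      change algebraMap F (AdjoinRoot (φ.map (algebraMap K F))) x⁻¹ *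
        algebraMap F (AdjoinRoot (φ.map (algebraMap K F))) x = 1
      rw [map_inv₀, inv_mul_cancel₀ ((_root_.map_ne_zero _).mpr hx0)]
    obtain ⟨u, hu'⟩ := hloc.map_nonunit _ hu
    apply hxP
    have h1 : ((u⁻¹ : P.toValuationSubringˣ) : F) * x⁻¹ = 1 := by
      have := congrArg (fun z : P.toValuationSubring => (z : F)) u.inv_mul
      rwa [hu'] at this
    rw [mul_inv_eq_one₀ hx0] at h1
    rw [← h1]
    exact SetLike.coe_mem _
  -- `A ≠ F'`
  have hAtop : A ≠ ⊤ := by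
    intro hAT
    have hπ := P.irreducible_uniformizer
    apply hπ.not_isUnit
    apply hloc.map_nonunit
    have hπ0 : (P.uniformizer : F) ≠ 0 := fun h => hπ.ne_zero (Subtype.ext h)
    refine IsUnit.of_mul_eq_one ⟨(algebraMap F (AdjoinRoot (φ.map (algebraMap K F)))
      P.uniformizer)⁻¹, hAT ▸ ValuationSubring.mem_top _⟩ ?_
    apply Subtype.ext
    change algebraMap F _ (P.uniformizer : F) * (algebraMap F _ (P.uniformizer : F))⁻¹ = 1
    rw [mul_inv_cancel₀ ((_root_.map_ne_zero _).mpr hπ0)]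
  -- constants: `K ⊆ A`, hence `K' ⊆ A` (`K'/K` algebraic, `A` contains all `K`-algebraic elements)
  have hKA : ∀ c : K, algebraMap K (AdjoinRoot (φ.map (algebraMap K F))) c ∈ A := fun c => by
    rw [IsScalarTower.algebraMap_apply K F (AdjoinRoot (φ.map (algebraMap K F)))]
    exact hA ⟨algebraMap K F c, P.algebraMap_mem c⟩
  haveI : IsAlgFunctionField K (AdjoinRoot (φ.map (algebraMap K F))) :=
    isAlgFunctionField_of_finiteDimensional (K := K) (F := F)
  have hK'A : ∀ c : AdjoinRoot φ, algebraMap (AdjoinRoot φ) (AdjoinRoot (φ.map (algebraMap K F))) c ∈ A :=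
    fun c => IsAlgFunctionField.mem_valuationSubring_of_isAlgebraic (K := K) A hKA
      ((Algebra.IsAlgebraic.isAlgebraic (R := K) c).algebraMap)
  refine ⟨⟨A, hAtop, IsAlgFunctionField.isDiscreteValuationRing_of_ne_top_of_algebraMap_mem
    (K := K) A hAtop hKA, hK'A⟩, ?_⟩
  apply PlaceOver.ext
  ext x
  exact ⟨key x, fun hx => hA ⟨x, hx⟩⟩

end PlaceAbove

/-! ### Infinitely divisible modulo constants ⇒ constant -/

section Divisible

variable {k : Type u} {F : Type v} {Ω : Type w} [Field k] [CharZero k] [Field F] [Algebra k F]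
  [IsAlgFunctionField k F] [Field Ω] [Algebra F Ω] [Algebra k Ω] [IsScalarTower k F Ω]

/-- `ord_Q (y ^ n) = n · ord_Q y` for `y ≠ 0` (Stichtenoth Thm. 1.1.13 (a)).
[cite: Stichtenoth2009, Thm. 1.1.13(a)] -/
theorem PlaceOver.ord_pow_eq {K' : Type*} {F' : Type*} [Field K'] [Field F'] [Algebra K' F']
    (Q : PlaceOver K' F') {y : F'} (hy : y ≠ 0) (n : ℕ) : Q.ord (y ^ n) = n * Q.ord y := by
  induction n with
  | zero =>
    have h := PlaceOver.ord_mul_holds Q (x := (1 : F')) (y := 1) one_ne_zero one_ne_zero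
    rw [mul_one] at h
    rw [pow_zero, Nat.cast_zero, zero_mul]
    omega
  | succ n ih =>
    rw [pow_succ, PlaceOver.ord_mul_holds Q (pow_ne_zero n hy) hy, ih]
    push_cast
    ring

/-- **An element of a function field which, for every `n`, becomes an `n`-th power after a finite
extension of the constant field is a constant.**  Let `F/k` be an algebraic function field of one
variable (`char k = 0`), `Ω ⊇ F` a field, `c ∈ F^×`; suppose that for every `n ≥ 1` there are a
finite extension `N ⊆ Ω` of `k` and `β ∈ F·N ⊆ Ω` with `βⁿ = c`.  Then `c` is algebraic over `k`.
Proof: otherwise `c` has a pole `P` over the exact constant field `k̃` of `F` (Stichtenoth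
Cor. 1.1.20); `F·N = F(t) ≅ F[X]/(φ)`, `φ` the minimal polynomial over `k̃` of a primitive element
`t` of `k̃·N`, is a constant field extension, which is UNRAMIFIED (Stichtenoth Thm. 3.6.3 (a)): at a
place `Q` above `P`, `ord_Q(c) = ord_P(c) = n · ord_Q(β)`, impossible for `n > |ord_P(c)|`.
[cite: Stichtenoth2009, Thm. 3.6.3(a) and Cor. 1.1.20] -/
theorem isAlgebraic_of_forall_exists_pow_eq {c : F} (hc0 : c ≠ 0)
    (h : ∀ n : ℕ, 0 < n → ∃ N : IntermediateField k Ω, FiniteDimensional k N ∧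
      ∃ β ∈ IntermediateField.adjoin F (N : Set Ω), β ^ n = algebraMap F Ω c) :
    IsAlgebraic k c := by
  by_contra hc
  haveI := isAlgFunctionField_algebraicClosure_of_field (k := k) (F := F)
  haveI := isIntegrallyClosedIn_algebraicClosure_of_field (k := k) (F := F)
  haveI : CharZero (algebraicClosure k F) :=
    charZero_of_injective_algebraMap (algebraMap k (algebraicClosure k F)).injective
  -- `c` is transcendental over the exact constant field, so it has a pole `P`
  have hcK : Transcendental (algebraicClosure k F) c := by
    intro halg
    exact hc (isIntegral_trans c halg.isIntegral).isAlgebraic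
  obtain ⟨P, hcP⟩ := exists_placeOver_not_mem hcK
  have hord : P.ord c < 0 := by
    rcases lt_or_ge (P.ord c) 0 with h' | h'
    · exact h'
    · exact absurd ((PlaceOver.mem_toValuationSubring_iff_ord_nonneg P hc0).2 h') hcP
  -- choose `n > |ord_P c|` and the data `N`, `β`
  obtain ⟨N, hNfin, β, hβ, hβn⟩ := h ((P.ord c).natAbs + 1) (Nat.succ_pos _)
  haveI := hNfin
  -- the compositum over `F` is generated by a primitive element `t` of `N/k`
  obtain ⟨a, ha⟩ := Field.exists_primitive_element k N
  set t : Ω := (a : Ω) with htdef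
  have hNt : (N : Set Ω) ⊆ (IntermediateField.adjoin F {t} : Set Ω) := by
    have hN : N = k⟮t⟯ := by
      rw [htdef, ← IntermediateField.lift_adjoin_simple, ha, IntermediateField.lift_top]
    have hle : k⟮t⟯ ≤ (IntermediateField.adjoin F {t}).restrictScalars k :=
      IntermediateField.adjoin_le_iff.mpr (by
        simp only [Set.singleton_subset_iff, IntermediateField.coe_restrictScalars, SetLike.mem_coe]
        exact IntermediateField.mem_adjoin_simple_self F t)
    intro y hy
    rw [hN] at hy
    exact hle hy
  have hβt : β ∈ IntermediateField.adjoin F {t} :=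
    (IntermediateField.adjoin_le_iff.mpr hNt) hβ
  -- the minimal polynomial `φ` of `t` over `k̃` (`Ω` is a `k̃`-algebra through `F`)
  have hta : IsAlgebraic k t := by
    rw [htdef]
    exact (Algebra.IsAlgebraic.isAlgebraic (R := k) a).algebraMap
  have htK : IsIntegral (algebraicClosure k F) t := (hta.tower_top (algebraicClosure k F)).isIntegral
  set φ : (algebraicClosure k F)[X] := minpoly (algebraicClosure k F) t with hφdef
  haveI hφirr : Fact (Irreducible φ) := ⟨minpoly.irreducible htK⟩
  -- the model `F' = F[X]/(φ)` of `F(t)` and the evaluation hom `e : F' → Ω`, `X ↦ t`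
  have heval : (φ.map (algebraMap (algebraicClosure k F) F)).eval₂ (algebraMap F Ω) t = 0 := by
    rw [eval₂_map, ← IsScalarTower.algebraMap_eq, ← aeval_def, hφdef, minpoly.aeval]
  set e : AdjoinRoot (φ.map (algebraMap (algebraicClosure k F) F)) →+* Ω :=
    AdjoinRoot.lift (algebraMap F Ω) t heval with hedef
  have htF : IsIntegral F t := htK.tower_top
  have hβ' : ∃ q : F[X], aeval t q = β := by
    have h1 : β ∈ (IntermediateField.adjoin F {t}).toSubalgebra := hβt
    rw [IntermediateField.adjoin_simple_toSubalgebra_of_isAlgebraic htF.isAlgebraic,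
      Algebra.adjoin_singleton_eq_range_aeval, AlgHom.mem_range] at h1
    exact h1
  obtain ⟨q, hq⟩ := hβ'
  have heβ : e (AdjoinRoot.mk _ q) = β := by
    rw [hedef, AdjoinRoot.lift_mk, ← hq, aeval_def]
  have hec : e (algebraMap F _ c) = algebraMap F Ω c := by
    rw [hedef, AdjoinRoot.algebraMap_eq, AdjoinRoot.lift_of]
  have hpow : (AdjoinRoot.mk (φ.map (algebraMap (algebraicClosure k F) F)) q) ^
      ((P.ord c).natAbs + 1) = algebraMap F _ c :=
    e.injective (by rw [map_pow, heβ, hβn, hec])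
  have hβ0 : AdjoinRoot.mk (φ.map (algebraMap (algebraicClosure k F) F)) q ≠ 0 := by
    intro h0
    rw [h0, zero_pow (Nat.succ_ne_zero _)] at hpow
    exact (_root_.map_ne_zero (algebraMap F (AdjoinRoot (φ.map _)))).mpr hc0 hpow.symm
  -- a place above `P`; the constant field extension is unramified there
  obtain ⟨Q, hQ⟩ := exists_placeOver_adjoinRoot_restrict_eq φ P
  have h1 : Q.ord (algebraMap F _ c) = P.ord c := by
    rw [ord_algebraMap_eq_ord_restrict φ Q c, hQ]
  have h2 := PlaceOver.ord_pow_eq Q hβ0 ((P.ord c).natAbs + 1)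
  rw [hpow, h1] at h2
  have hdvd : (((P.ord c).natAbs + 1 : ℕ) : ℤ) ∣ P.ord c := ⟨_, h2⟩
  have hlt : (P.ord c).natAbs < (((P.ord c).natAbs + 1 : ℕ) : ℤ).natAbs := by
    rw [Int.natAbs_natCast]
    exact Nat.lt_succ_self _
  exact hord.ne (Int.eq_zero_of_dvd_of_natAbs_lt_natAbs hdvd hlt)

end Divisible

end Literature.AnabelianGeometry.AbsoluteAnabelian.AbsTopIII
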